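import Summits.BirchSwinnertonDyer.BirchSwinnertonDyer.Theses.TwistFamilyManinDescent

/-!
# Star-swap law and the Stevens-at-5 residual's residual — sketch (crux stmt-BirchSwinnertonDyer-25138, seat 1, g7)

Companion to `Ideas/etale-quotient-depth-calibration.md` §8 (this crux directory).  Three things, all
kernel-checked, no `sorry`:

* `starSwapTable` (+ `starSwap_five_cells`, `starSwap_ordinary_rigid`) — the finite arithmetic behind the STAR-SWAP LAW of §8a: for a cyclic `p`-isogeny
  `ψ : E → E'` of additive potentially SUPERSINGULAR curves at `p ≥ 5` with the same tame index
  `e ∈ {3, 4, 6}` and minimal-discriminant valuations `v, v' ∈ {12k/e : 0 < k, 12k/e < 12, gcd}`,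
  the Néron/tame comparison `e · v_p(α) = v_L(α_L) − (e/12)(v' − v)` with `0 < v_L(α_L) < e`
  (both `ψ` and its dual are non-étale over `O_L`) forces: `ψ` étale over `ℤ_p` (`v_p α = 0`) iff
  `v < 6 ∧ v' = 12 − v` (unstarred → starred), and `v_p α = 1` iff `v > 6 ∧ v' = 12 − v`; equal
  types are impossible.  Stated over `ℕ` and closed by `decide`.
* the TYPED residual's residual of lever (c) (§8d): `StarredPotSSAtFive W` (`v₅(Δ_min) ∈ {8, 10}`,
  types IV*, II*), `OptimalUnstarredAtFive` (= Q* of §8b, with the crux's own hypothesis list at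
  `p = 5`: conjecturally TRUE, i.e. the residual below is conjecturally VACUOUS — a Stevens-type
  statement, open in print for additive potentially supersingular `ℓ = 5`), `CruxOffStarredSSAtFive`
  (the crux minus those rows) and `StarredSSResidualAtFive` (the crux ON those rows);
* the two splits `crux_of_off_of_unstarred : CruxOffStarredSSAtFive → OptimalUnstarredAtFive → crux`
  and `crux_of_off_of_residual : CruxOffStarredSSAtFive → StarredSSResidualAtFive → crux`.

Nothing here is E-blind and nothing here proves the crux; BSD is not proved by this; Manin `c = 1` is
not proved by this.
-/

noncomputable section

set_option linter.dupNamespace false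
-- the nested bounded quantifiers of the finite tables need a larger instance-synthesis budget
set_option synthInstance.maxSize 8192
set_option synthInstance.maxHeartbeats 400000

open WeierstrassCurve Literature.NumberTheory.EllipticCurves.ModularForms

namespace Summit.BirchSwinnertonDyer.BirchSwinnertonDyer.Cruxes.EisensteinAdditiveManinResidual.StarSwap

/-! ### §8a  The star-swap arithmetic -/

/-- Admissible minimal-discriminant valuations of an additive potentially good curve at `p ≥ 5` with tame
index `e`: `e = 12 / gcd(12, v)`, `0 < v < 12` (a `Bool` test, so that the tables below close by `decide`). -/
def isTypeOf (e v : ℕ) : Bool := decide (0 < v ∧ v < 12 ∧ e * Nat.gcd 12 v = 12)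

/-- Sanity: the types of index 6 are II, II* (`v ∈ {2, 10}`), of index 3 are IV, IV* (`v ∈ {4, 8}`), of
index 4 are III, III* (`v ∈ {3, 9}`). -/
theorem isTypeOf_table :
    (∀ v < 12, isTypeOf 6 v = true ↔ v = 2 ∨ v = 10) ∧ (∀ v < 12, isTypeOf 3 v = true ↔ v = 4 ∨ v = 8) ∧
    (∀ v < 12, isTypeOf 4 v = true ↔ v = 3 ∨ v = 9) := by
  refine ⟨?_, ?_, ?_⟩ <;> decide

/-- **Star-swap table** (one statement per tame index `e ∈ {3, 4, 6}`).  `k = v_L(α_L) ∈ (0, e)`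
(potentially supersingular: neither `ψ` nor its dual is étale over the tame field), `a = v_p(α) ∈ {0, 1}`,
and the comparison identity multiplied by 12: `12·e·a + e·v' = 12·k + e·v` (i.e. `e·a = k − (e/12)(v' − v)`).
Conclusion: the étale direction (`a = 0`) goes from the unstarred type `v < 6` to the starred partner
`v' = 12 − v`, the non-étale one (`a = 1`) the other way, and `v = v'` never happens. -/
def StarSwapRow (e : ℕ) : Prop :=
  ∀ v < 12, ∀ v' < 12, ∀ k < e, ∀ a < 2,
    isTypeOf e v = true → isTypeOf e v' = true → 0 < k →
    12 * e * a + e * v' = 12 * k + e * v →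
    v + v' = 12 ∧ (a = 0 ↔ v < 6) ∧ v ≠ v'

theorem starSwapTable : StarSwapRow 3 ∧ StarSwapRow 4 ∧ StarSwapRow 6 := by
  unfold StarSwapRow; refine ⟨?_, ?_, ?_⟩ <;> decide

/-- The potentially supersingular cells at `p = 5` read off the table (`e = 6`: II → II*, `e = 3`:
IV → IV*): the étale `5`-isogeny out of the unstarred curve lands on `v₅(Δ_min) = 12 − v ∈ {10, 8}`. -/
theorem starSwap_five_cells :
    (∀ v' < 12, ∀ k < 6, isTypeOf 6 v' = true → 0 < k → 12 * 6 * 0 + 6 * v' = 12 * k + 6 * 2 → v' = 10) ∧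
    (∀ v' < 12, ∀ k < 3, isTypeOf 3 v' = true → 0 < k → 12 * 3 * 0 + 3 * v' = 12 * k + 3 * 4 → v' = 8) := by
  constructor <;> decide

/-- In the potentially ORDINARY cells (`k ∈ {0, e}`: one of `ψ`, `ψ^∨` is étale over the tame field) the
same identity forces EQUAL types (`v = v'`): (5; III/III*), (7; II/II*, IV/IV*), (13; all). -/
theorem starSwap_ordinary_rigid :
    ∀ e < 7, (e = 3 ∨ e = 4 ∨ e = 6) → ∀ v < 12, ∀ v' < 12, ∀ a < 2,
      isTypeOf e v = true → isTypeOf e v' = true →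
      (12 * e * a + e * v' = 12 * 0 + e * v ∨ 12 * e * a + e * v' = 12 * e + e * v) → v = v' := by
  decide

/-! ### §8d  The typed residual's residual of lever (c) -/

/-- `W` (a GLOBALLY MINIMAL model in the crux's binders, so `W.Δ` is the minimal discriminant) is STARRED
potentially supersingular at `5`: Kodaira type IV* or II*, `v₅(Δ_min) ∈ {8, 10}`.  (Under the crux's
hypotheses `5² ∣ N` and «the `5*`-twist is neither good nor multiplicative» the other additive types with
these valuations, I₂* and I₄*, are excluded, and `e ∈ {3, 6}` is supersingular at `5`.) -/
def StarredPotSSAtFive (W : WeierstrassCurve ℚ) : Prop :=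
  padicValRat 5 W.Δ = 8 ∨ padicValRat 5 W.Δ = 10

/-- **Q\* (§8b), typed with the crux's own hypothesis list at `p = 5`.**  «An `X₀(N)`-lattice-optimal curve
with `5² ∣ N`, `E[5]` reducible and twist-minimal additive potentially good reduction at `5` is never of
type IV* or II*.»  Equivalent forms (§8b): the rational `5`-isogeny out of the optimal curve is étale;
`5 ∤ deg(E_min → E₀)`; implied by Stevens' conjecture at `5` plus `5 ∤ #(E₀ ∩ Σ(N))`.  Evidence: Cremona
`N < 5·10⁵`, 1542/1542 optimal rows (sibling census `Cruxes/ManinPrimeToAdditiveFiveLe/Lines/two-parity-k2-census.md`,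
table A, p = 5 SS cells).  CONJECTURE — open in print for additive `ℓ = 5` (Vatsal 2005 Thm 1.10/1.11,
Byeon–Kim 2014 Thm 1.1 are semistable / `5 ∤ N`). -/
def OptimalUnstarredAtFive : Prop :=
  ∀ (W : WeierstrassCurve ℚ) [W.IsElliptic] [W.IsGloballyMinimal] {N : ℕ} [NeZero N]
    (D : ModularParametrizationData W N) (hp : (5 : ℕ).Prime),
    5 ^ 2 ∣ N → ¬ W.HasIrreducibleModPGaloisRep 5 →
    ¬ ((W.quadraticTwist (((-1 : ℤ) ^ (5 / 2) * 5 : ℤ) : ℚ)).HasGoodReductionAt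
          ((Rat.HeightOneSpectrum.primesEquiv (R := ℤ)).symm ⟨5, hp⟩) ∨
       (W.quadraticTwist (((-1 : ℤ) ^ (5 / 2) * 5 : ℤ) : ℚ)).HasMultiplicativeReductionAt
          ((Rat.HeightOneSpectrum.primesEquiv (R := ℤ)).symm ⟨5, hp⟩)) →
    (∀ z ∈ D.L.lattice, ∃ w ∈ periodLattice D.f, z = D.c * w) →
    ¬ StarredPotSSAtFive W

/-- The crux OFF the starred potentially supersingular rows at `5` (all of `p ∈ {7, 13, 163}`, and at
`p = 5` the types II, III, III*, IV): the part the E-blind line (ΛM) + (H_J) of the calibration addresses. -/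
def CruxOffStarredSSAtFive : Prop :=
  mazur_not_dvd_maninConstant_of_odd → abbesUllmo_not_dvd_maninConstant_of_not_dvd_level →
  cesnavicius_not_two_dvd_maninConstant_of_two_dvd_level → exists_isNewformOf →
  ∀ (W : WeierstrassCurve ℚ) [W.IsElliptic] [W.IsGloballyMinimal] {N : ℕ} [NeZero N]
    (D : ModularParametrizationData W N) (p : ℕ) (hp : p.Prime),
    (p = 5 ∨ p = 7 ∨ p = 13 ∨ (p = 163 ∧ 2 ^ 6 ∣ N)) → p ^ 2 ∣ N → ¬ W.HasIrreducibleModPGaloisRep p →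
    ¬ ((W.quadraticTwist (((-1 : ℤ) ^ (p / 2) * p : ℤ) : ℚ)).HasGoodReductionAt
          ((Rat.HeightOneSpectrum.primesEquiv (R := ℤ)).symm ⟨p, hp⟩) ∨
       (W.quadraticTwist (((-1 : ℤ) ^ (p / 2) * p : ℤ) : ℚ)).HasMultiplicativeReductionAt
          ((Rat.HeightOneSpectrum.primesEquiv (R := ℤ)).symm ⟨p, hp⟩)) →
    (∀ z ∈ D.L.lattice, ∃ w ∈ periodLattice D.f, z = D.c * w) →
    ¬ (p = 5 ∧ StarredPotSSAtFive W) →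
    ¬ (p : ℤ) ∣ D.maninConstant

/-- **R_c — the residual's residual of lever (c)**: the crux ON the starred potentially supersingular rows at
`5` (optimal IV*/II*, the only cell with `a(E) = v₅Δ/12 > κ₅ = 3/4` being II*).  Conjecturally VACUOUS
(`OptimalUnstarredAtFive`). -/
def StarredSSResidualAtFive : Prop :=
  mazur_not_dvd_maninConstant_of_odd → abbesUllmo_not_dvd_maninConstant_of_not_dvd_level →
  cesnavicius_not_two_dvd_maninConstant_of_two_dvd_level → exists_isNewformOf →
  ∀ (W : WeierstrassCurve ℚ) [W.IsElliptic] [W.IsGloballyMinimal] {N : ℕ} [NeZero N]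
    (D : ModularParametrizationData W N) (hp : (5 : ℕ).Prime),
    5 ^ 2 ∣ N → ¬ W.HasIrreducibleModPGaloisRep 5 →
    ¬ ((W.quadraticTwist (((-1 : ℤ) ^ (5 / 2) * 5 : ℤ) : ℚ)).HasGoodReductionAt
          ((Rat.HeightOneSpectrum.primesEquiv (R := ℤ)).symm ⟨5, hp⟩) ∨
       (W.quadraticTwist (((-1 : ℤ) ^ (5 / 2) * 5 : ℤ) : ℚ)).HasMultiplicativeReductionAt
          ((Rat.HeightOneSpectrum.primesEquiv (R := ℤ)).symm ⟨5, hp⟩)) →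
    (∀ z ∈ D.L.lattice, ∃ w ∈ periodLattice D.f, z = D.c * w) →
    StarredPotSSAtFive W →
    ¬ (5 : ℤ) ∣ D.maninConstant

/-- **Split 1 (conjectural vacuity).**  Off-rows crux + Q* ⇒ the crux. PROVED. -/
theorem crux_of_off_of_unstarred (hoff : CruxOffStarredSSAtFive) (hQ : OptimalUnstarredAtFive) :
    Theses.TwistFamilyManinDescent.EisensteinAdditiveManinResidual := by
  intro h1 h2 h3 h4 W _ _ N _ D p hp hrows hN hred htw hlat
  refine hoff h1 h2 h3 h4 W D p hp hrows hN hred htw hlat ?_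
  rintro ⟨rfl, hstar⟩
  exact hQ W D hp hN hred htw hlat hstar

/-- **Split 2 (honest remainder).**  Off-rows crux + the residual's residual ⇒ the crux. PROVED. -/
theorem crux_of_off_of_residual (hoff : CruxOffStarredSSAtFive) (hR : StarredSSResidualAtFive) :
    Theses.TwistFamilyManinDescent.EisensteinAdditiveManinResidual := by
  intro h1 h2 h3 h4 W _ _ N _ D p hp hrows hN hred htw hlat
  by_cases hc : p = 5 ∧ StarredPotSSAtFive W
  · obtain ⟨rfl, hstar⟩ := hc
    exact hR h1 h2 h3 h4 W D hp hN hred htw hlat hstar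
  · exact hoff h1 h2 h3 h4 W D p hp hrows hN hred htw hlat hc

/-- Conversely the crux gives both pieces (so the split loses nothing). PROVED. -/
theorem off_and_residual_of_crux (h : Theses.TwistFamilyManinDescent.EisensteinAdditiveManinResidual) :
    CruxOffStarredSSAtFive ∧ StarredSSResidualAtFive :=
  ⟨fun h1 h2 h3 h4 W _ _ _ _ D p hp hrows hN hred htw hlat _ =>
      h h1 h2 h3 h4 W D p hp hrows hN hred htw hlat,
   fun h1 h2 h3 h4 W _ _ _ _ D hp hN hred htw hlat _ =>
      h h1 h2 h3 h4 W D 5 hp (Or.inl rfl) hN hred htw hlat⟩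

end Summit.BirchSwinnertonDyer.BirchSwinnertonDyer.Cruxes.EisensteinAdditiveManinResidual.StarSwap
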